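import Literature.MathematicalPhysics.QuantumFieldTheory.Balaban1983to89.B9Eq346GradGpDivAtPinsL2KnitClosed
import Literature.MathematicalPhysics.QuantumFieldTheory.Balaban1983to89.B9BackgroundsKLevelV1R
import Literature.MathematicalPhysics.QuantumFieldTheory.Balaban1983to89.B9Eq335ClassBridgePV1
import Literature.MathematicalPhysics.QuantumFieldTheory.Balaban1983to89.B9PinGeometryKLevelV1B
import Literature.MathematicalPhysics.QuantumFieldTheory.Balaban1983to89.Node00.OpsYRecordV11Thresh

/-!
# BalabanUVNodes ∕ N06 ([B9], `Dag.B9_main`) — CASCADE-K: THE KNIT (3.46)₄ LAW `h46K` OF THE STAGE-11 CERTIFICATE («KC» ✓p795195 ∕ «KE₁» ✓p795758) IN ITS OWN BINDER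
# SHAPE, AT THE NAMED CONSTANTS `M46K a46K B46K δ46K` (`B9Eq346GradGpDivAtPinsL2KnitClosed`), FROM THE CERTIFICATE's REGIME BRIDGE `hRP1` AND THE x-FREE KNIT NUMERICS
# — the input «KE₂» folds `h46K` with (dag-n06-d HOME HANDOFF § gen 26: «h46K n06-l ✓p781812»)

T. Bałaban, *Propagators for lattice gauge theories in a background field*, Commun. Math. Phys. **99** (1985) 389–434 [`Balaban1985BackgroundPropagators`], Thm 3.1 (3.46) p. 398,
(3.19) p. 393, (3.24) p. 394, (3.35) p. 396; *Averaging operations for lattice gauge theories*, Commun. Math. Phys. **98** (1985) 17–51 [`Balaban1985Averaging`], Prop. 2 (52)–(53)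
p. 26; *Propagators … II*, Commun. Math. Phys. **96** (1984) 223–250 [`Balaban1984PropagatorsII`], (2.46) p. 231, (2.51)–(2.54) pp. 232–233.

Track A of `YM-PLAN.md` (cell `pub-ymgap`, HUMAN RULING D-0062), node **N06**; bundle F7 rows 20–21, seat `pub-ymgap-dag-n06-l` (g40).  WHY.  «KE₁» displays
`h46K : ∀ x, M46K ≤ M → ∀ α₀ > 0, M·α₀ ≤ a46K → ∀ U ∈ (bg9YR … R₁ R₂ x).Reg335 c α₀, BlockBd (toB6 (geo9Y x) 1 (H x)) (blkBK (bI x)) (blkBK (bI x)) (D_U ∘ G′(U; parKnitY) ∘ D*_U)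
(B46K·e^{−δ46K·d})` with `M46K a46K B46K δ46K` as BINDERS tied to other displays (`hrT4 : rT ≤ δ46K`).  My ✓p781812 `blockBd_DvGcoSDvs_memberY_knit` is an `∃ M₄ a₄ B₄ δ₄`
over print's member classes (`bg9KP … c₀ α₀` for the knit legs, `bg9Y … c α₁` for the Agmon machinery) with the knit numerics explicit; the certificate cannot open that `∃` (the
rate is shared), so `B9Eq346GradGpDivAtPinsL2KnitClosed` NAMES the constants, and THIS FILE packages the law in «KE₁»'s binder text at `(M46K, a46K, B46K, δ46K) :=
(M46K …, min (a46K …) aK, B46K …, δ46K …)`: ★★★ `h46K_knit_of_pinsR` — inputs «KE₁»'s own binders `hc hcB hGR`-free `hRP1` (regime bridge to print's member class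
`bg9YP … c35Y`, both halves used: `{Ω_j}`-half for [5] Prop. 2 at the retraction, the pair for MODULE 3's small-cube class at `c ≥ c35B = 10·L⁴ ≥ 10·L³`), the x-free knit
numerics `hα′ hα3 hα2` (= `hαK hαK3 hαK2`), `hαd : (d+1)²α₀′ ≤ 1∕100` (the K-0 coercivity window), the index-keyed plaquette threshold `hKplK` (∀ i, a ≤ aK), and the
bond-map laws `hlev hβ1` of `bI` (`OpsYBondMapOfRecord.lawsY_of_eq hbI`).  «KE₂» RECIPE: `(M46K := M46K θ.d₆ θ.ℓ₆ θ.hd' θ.hL' θ.b₀ θ.b₁ Mstar N c hc)`, `(a46K := min (a46K …) aK)`,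
`(B46K := B46K …)`, `(δ46K := δ46K …)`, `(hM46K := M46K_pos …)`, `(ha46K := lt_min (a46K_pos …) (lt_of_lt_of_le (div_pos hp.a₁_pos hc) hpaK))`, `(hB46K := B46K_pos …)`,
`(h46K := h46K_knit_of_pinsR θ.toStage3Params Mstar hc hcB hRP1 hαK hαK3 hαK2 hαdK hKplK bI hlev hβ1 H)`, `hrT4 : rT ≤ δ46K …` displayed at the closed term.
HONEST FRAMING.  Kernel bookkeeping over landed modules; the (3.46)₄ estimate itself is ✓p781812 (dag-n06-l g37, P-346K); COUNT-NEUTRAL; N06 NOT discharged; one finite 𝕋⁴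
programme at fixed `ε` — NOT continuum, NOT OS, NOT the mass gap ∕ Clay.  0 `def`, 0 `sorry`, no `instance`, no `notation`.  NEW file.
RELATED, NOT DUPLICATED (searched 2026-08-30: `rg -l -w "N06Eq346KnitLegAtPinsR|h46K_knit_of_pinsR"` over `lean/{Literature,Summits,HarnessLib}` = ∅): ✓`B9Eq346GradGpDivAtPinsL2Closed`
∕ the straight `h46` fold inside edition 125 «WA» (`blockBd_DvGcoSDvs_memberY_at` + `hY335`), whose pattern this file repeats at the knit transporter.
-/

noncomputable section

namespace Summit.QuantumFields.YangMills.BalabanUVNodes.N06Eq346KnitLegAtPinsR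

open scoped Matrix.Norms.L2Operator
open Literature.MathematicalPhysics.QuantumFieldTheory.Balaban1983to89
open Literature.MathematicalPhysics.QuantumFieldTheory.Balaban1983to89.Node00
open Literature.MathematicalPhysics.QuantumFieldTheory.Balaban1983to89.B6KLevelCensusIndexV1 (KIdx kGeo)
open Literature.MathematicalPhysics.QuantumFieldTheory.Balaban1983to89.B6Ineq2142KLevelV1 (lvl β)
open Literature.MathematicalPhysics.QuantumFieldTheory.Balaban1983to89.B6GlobalChartV1 (blkV1)
open Literature.MathematicalPhysics.QuantumFieldTheory.Balaban1983to89.B6Geom246MultiLevelTorus (geomT)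
open Literature.MathematicalPhysics.QuantumFieldTheory.Balaban1983to89.B9PinMembersKLevelV1 (MemberY geo9Y bg9Y)
open Literature.MathematicalPhysics.QuantumFieldTheory.Balaban1983to89.B9BackgroundsKLevelV1P (bg9KP bg9YP)
open Literature.MathematicalPhysics.QuantumFieldTheory.Balaban1983to89.B9BackgroundsKLevelV1R (RegFamY bg9YR MemOfFam)
open Literature.MathematicalPhysics.QuantumFieldTheory.Balaban1983to89.B9PinGeometryKLevelV1 (c35Y c35Y_eq)
open Literature.MathematicalPhysics.QuantumFieldTheory.Balaban1983to89.B9PinGeometryKLevelV1B (c35B ten_L3_le_c35B)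
open Literature.MathematicalPhysics.QuantumFieldTheory.Balaban1983to89.B9Eq335ClassBridgePV1 (regY335_of_regYP335)
open Literature.MathematicalPhysics.QuantumFieldTheory.Balaban1983to89.B7Prop2SpecialUnitary (specialUnitaryUnits specialUnitaryUnits_le_unitaryUnits)
open Literature.MathematicalPhysics.QuantumFieldTheory.Balaban1983to89.B7Prop2Explicit (C0 c2')
open Literature.MathematicalPhysics.QuantumFieldTheory.Balaban1983to89.B9C2FormBoxRegimeY (Kpl)
open Literature.MathematicalPhysics.QuantumFieldTheory.Balaban1983to89.B9CoReadingCoords (XBK blkBK)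
open Literature.MathematicalPhysics.QuantumFieldTheory.Balaban1983to89.B9CoReadingCoordsS (GcoS)
open Literature.MathematicalPhysics.QuantumFieldTheory.Balaban1983to89.B9CoReadingCoordsTranspose (TrIdx trBasis)
open Literature.MathematicalPhysics.QuantumFieldTheory.Balaban1983to89.B9Thm34Ext (toB6)
open Literature.MathematicalPhysics.QuantumFieldTheory.Balaban1983to89.B9SectDL2Decay (BlockBd)
open Literature.MathematicalPhysics.QuantumFieldTheory.Balaban1983to89.Node00.OpsYSectDCoords (DvcoKH DvscoKH)
open Literature.MathematicalPhysics.QuantumFieldTheory.Balaban1983to89.B9B8AveragingJunction (parKnitY)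
open Literature.MathematicalPhysics.QuantumFieldTheory.Balaban1983to89.B9Eq346GradGpDivAtPinsL2KnitClosed (M46K a46K B46K δ46K blockBd_DvGcoSDvs_memberY_knit_at)

variable {N : ℕ} [NeZero N] (θ : Stage3Params) (Mstar : ℕ) [∀ x : MemberY θ.d₆ θ.ℓ₆ θ.hd' θ.hL' θ.b₀ θ.b₁ Mstar, Fintype (geo9Y x).Site]
  {R₁ R₂ : RegFamY θ.d₆ θ.ℓ₆ θ.hd' θ.hL' θ.b₀ θ.b₁ Mstar (Matrix (Fin N) (Fin N) ℂ)} {c : ℝ}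

/-- ★★★ **THE CERTIFICATE's KNIT (3.46)₄ LAW `h46K` IN ITS OWN BINDER SHAPE, AT THE NAMED CONSTANTS** — «KE₁»'s display
`∀ x, M46K ≤ M → ∀ α₀ > 0, M·α₀ ≤ a46K → ∀ U ∈ (bg9YR … R₁ R₂ x).Reg335 c α₀, BlockBd (toB6 (geo9Y x) 1 (H x)) (blkBK (bI x)) (blkBK (bI x)) (DvcoKH U ∘ GcoS (GpY (parKnitY)) U ∘ DvscoKH U) (B46K·e^{−δ46K·d})`
VERBATIM at `(M46K, a46K, B46K, δ46K) := (M46K …, min (a46K …) aK, B46K …, δ46K …)`, from: `0 < c`, `c35B ≤ c` (the certificate's `hc hcB`), the regime bridge `hRP1` to print's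
member class `bg9YP … c35Y` (its `{Ω_j}`-half feeds [5] Prop. 2 at the retraction — knit legs unitary, coercivity `1∕32` of `Δ′_a(U; parKnitY)` —, the pair feeds MODULE 3's class
`bg9Y … c α₀` via `regY335_of_regYP335`, `10·L³ ≤ c35B ≤ c`), the x-free knit numerics `hα′ hα3 hα2 hαd`, the index-keyed plaquette threshold `hKplK` (`a ≤ aK`, whence the
`min … aK`), and the bond-map laws `hlev hβ1`.  The estimate is ✓p781812 `blockBd_DvGcoSDvs_memberY_knit`, read at the closed terms by `blockBd_DvGcoSDvs_memberY_knit_at`.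
[cite: Balaban1985BackgroundPropagators, Thm 3.1 (3.46) p.398, (3.19) p.393, (3.24) p.394, (3.35) p.396; Balaban1985Averaging, Prop. 2 (52)–(53) p.26; Balaban1984PropagatorsII, (2.46) p.231, (2.51)–(2.54) pp.232–233] -/
theorem h46K_knit_of_pinsR (hc : 0 < c) (hcB : c35B θ.ℓ₆ ≤ c)
    (hRP1 : ∀ (x : MemberY θ.d₆ θ.ℓ₆ θ.hd' θ.hL' θ.b₀ θ.b₁ Mstar) (α₀ : ℝ) (U : (bg9YR (Matrix (Fin N) (Fin N) ℂ) (specialUnitaryUnits (Fin N)) R₁ R₂ x).Cfg),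
      (bg9YR (Matrix (Fin N) (Fin N) ℂ) (specialUnitaryUnits (Fin N)) R₁ R₂ x).Reg335 c α₀ U →
        0 ≤ α₀ ∧ (bg9YP (Matrix (Fin N) (Fin N) ℂ) (specialUnitaryUnits (Fin N)) x).Reg335 c35Y α₀ U)
    {α₀' aK : ℝ} (hα' : 0 < α₀') (hα3 : C0 (θ.d₆ + 1) * α₀' ≤ 1 / 3) (hα2 : 2 * α₀' ≤ c2' (θ.d₆ + 1) (θ.ℓ₆ + 1))
    (hαd : ((θ.d₆ : ℝ) + 1) ^ 2 * α₀' ≤ 1 / 100)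
    (hKplK : ∀ (i : KIdx θ.d₆ θ.ℓ₆ θ.hd' θ.hL' θ.b₀ θ.b₁) (a : ℝ), 0 ≤ a → a ≤ aK → Kpl i a * (kGeo i).L ^ 4 < α₀')
    (bI : ∀ x : MemberY θ.d₆ θ.ℓ₆ θ.hd' θ.hL' θ.b₀ θ.b₁ Mstar, FBondY x.toKIdx → IBondY x.toKIdx)
    (hlev : ∀ (x : MemberY θ.d₆ θ.ℓ₆ θ.hd' θ.hL' θ.b₀ θ.b₁ Mstar) (f : FBondY x.toKIdx), lvl x.hN x.D x.hk (bI x f) = (blkV1 x.hN x.D f).1.1)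
    (hβ1 : ∀ (x : MemberY θ.d₆ θ.ℓ₆ θ.hd' θ.hL' θ.b₀ θ.b₁ Mstar) (f : FBondY x.toKIdx), (geomT x.D).dist (β x.hN x.D x.hk (bI x f)) (blkV1 x.hN x.D f) ≤ 1)
    (H : MemberY θ.d₆ θ.ℓ₆ θ.hd' θ.hL' θ.b₀ θ.b₁ Mstar → Prop) :
    ∀ x : MemberY θ.d₆ θ.ℓ₆ θ.hd' θ.hL' θ.b₀ θ.b₁ Mstar, M46K θ.d₆ θ.ℓ₆ θ.hd' θ.hL' θ.b₀ θ.b₁ Mstar N c hc ≤ (geo9Y x).M → ∀ α₀ : ℝ, 0 < α₀ →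
      (geo9Y x).M * α₀ ≤ min (a46K θ.d₆ θ.ℓ₆ θ.hd' θ.hL' θ.b₀ θ.b₁ Mstar N c hc) aK →
      ∀ U : (bg9YR (Matrix (Fin N) (Fin N) ℂ) (specialUnitaryUnits (Fin N)) R₁ R₂ x).Cfg, (bg9YR (Matrix (Fin N) (Fin N) ℂ) (specialUnitaryUnits (Fin N)) R₁ R₂ x).Reg335 c α₀ U →
        B9SectDL2Decay.BlockBd (g := toB6 (geo9Y x) 1 (H x)) (blkBK x.toKIdx (bI x)) (blkBK x.toKIdx (bI x))
          (DvcoKH x.toKIdx (trBasis N) (bg9YR (Matrix (Fin N) (Fin N) ℂ) (specialUnitaryUnits (Fin N)) R₁ R₂ x) (fun U => U) U ∘ₗ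
            GcoS x.toKIdx (trBasis N) (bg9YR (Matrix (Fin N) (Fin N) ℂ) (specialUnitaryUnits (Fin N)) R₁ R₂ x) (fun U => U) (GpY x.toKIdx (parKnitY x.toKIdx)) U ∘ₗ
              DvscoKH x.toKIdx (trBasis N) (bg9YR (Matrix (Fin N) (Fin N) ℂ) (specialUnitaryUnits (Fin N)) R₁ R₂ x) (fun U => U) U)
          (fun (y y' : (geo9Y x).Site) => B46K θ.d₆ θ.ℓ₆ θ.hd' θ.hL' θ.b₀ θ.b₁ Mstar N c hc * Real.exp (-(δ46K θ.d₆ θ.ℓ₆ θ.hd' θ.hL' θ.b₀ θ.b₁ Mstar N c hc * (geo9Y x).dist y y'))) := by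
  intro x hM α₀ hα ha U hU
  have hMα : 0 ≤ (kGeo x.toKIdx).M * α₀ := kGeo_M_mul_nonneg x.toKIdx hα.le
  have hK : Kpl x.toKIdx ((geo9Y x).M * α₀) * (geo9Y x).L ^ 4 < α₀' :=
    Kpl_mul_L4_lt_of_thresh x.toKIdx (hKplK x.toKIdx ((geo9Y x).M * α₀) hMα (ha.trans (min_le_right _ _))) hα.le le_rfl
  have hY335 : (bg9Y (Matrix (Fin N) (Fin N) ℂ) (specialUnitaryUnits (Fin N)) x).Reg335 c α₀ U :=
    regY335_of_regYP335 x c35Y_eq.le (hRP1 x α₀ U hU).1 (hRP1 x α₀ U hU).2 ((ten_L3_le_c35B θ.ℓ₆).trans hcB)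
  exact blockBd_DvGcoSDvs_memberY_knit_at θ.d₆ θ.ℓ₆ θ.hd' θ.hL' θ.b₀ θ.b₁ Mstar N c hc
    (fun u hu => (CStarRing.norm_of_mem_unitary (B7Prop2Explicit.mem_unitaryUnits.1 (specialUnitaryUnits_le_unitaryUnits hu))).le)
    specialUnitaryUnits_le_unitaryUnits x hM c35Y_eq.le α₀ hα hα' hα3 hα2 hαd hK α₀ hα (ha.trans (min_le_left _ _)) U (hRP1 x α₀ U hU).2.1 hY335
    (hlev x) (hβ1 x) 1 (H x)

end Summit.QuantumFields.YangMills.BalabanUVNodes.N06Eq346KnitLegAtPinsR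

end
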